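import Mathlib.Algebra.Group.Basic
import Mathlib.Algebra.BigOperators.Group.Finset.Basic
import Mathlib.Tactic.Group
import Mathlib.Tactic.Abel
import HarnessLib

set_option linter.dupNamespace false

/-!
# Weil-type family coverage — TYPE-III WINDOWS, part K (census block b04.23): the ALGEBRAIC SKELETON of the HANDLE LEMMA (THEOREM S25.5)

research route conditional on HC_CM; not a corollary; Q11.4-sentence-2 already refuted in dim ≥ 3.

Ring 2, WEIL-TYPE FAMILY-COVERAGE CENSUS (`HOME/WEIL-FAMILY-COVERAGE.md` `## b04`, block b04.23, owner ring2-b04, gen 59; theory note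
`HOME/pub-hodge-ring2-b04/census-g59/theory/THEOREMS-S25.md` §2′).  SETTING (informal, NOT formalised): for a `G`-cover of a base of genus `q`
with Hurwitz datum `(α_1,β_1,…,α_q,β_q; g_1,…,g_b)`, `∏_j[α_j,β_j]∏_i g_i = 1`, THEOREM S25.5 says that the Witt class of the hidden-factor form
is `Σ_i u(g_i)` — handles are invisible —: cutting the base along the `a`-curve of a handle is a metabolic reduction which replaces the commutator
`[α,β]` in the Hurwitz relation by the two branch letters `α` and `βα^{−1}β^{−1}` (a conjugate of `α^{−1}`), and the local Witt term `u` of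
THEOREM S21 is an ODD CLASS FUNCTION, so each handle contributes `u(α) + u(βα^{−1}β^{−1}) = u(α) − u(α) = 0`.
THIS FILE proves in the kernel exactly these two algebraic steps, for an arbitrary group `G` and an arbitrary map `u : G → A` into an additive
commutative group that is a class function and odd: (1) the commutator splits as `α·(βα^{−1}β^{−1})`; (2) every handle term vanishes, hence the
sum over any finite family of handles vanishes and the total class is the sum over the branch letters alone.  The topology (S20's lemma for a
non-separating multicurve, metabolic reduction) and S21 itself are NOT formalised; `HC_CM` is used nowhere.  No `sorry`, no definitions.
-/

namespace Summit.HodgeConjecture.HodgeConjecture.Ring2.WeilCoverage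

open Finset

/-- The commutator of a handle splits into the two branch letters of the cut base: `αβα⁻¹β⁻¹ = α·(βα⁻¹β⁻¹)`, the second letter being the
conjugate of `α⁻¹` by `β⁻¹` (THEOREMS-S25 §2′, proof).
research route conditional on HC_CM; not a corollary; Q11.4-sentence-2 already refuted in dim ≥ 3. -/
theorem handle_commutator_split {G : Type*} [Group G] (α β : G) :
    α * β * α⁻¹ * β⁻¹ = α * (β * α⁻¹ * β⁻¹) := by
  group

/-- ONE HANDLE IS WITT-INVISIBLE (THEOREMS-S25 §2′): for a map `u : G → A` that is a class function (`u(hgh⁻¹) = u g`) and odd (`u g⁻¹ = −u g`) —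
as the local Witt term of THEOREM S21 is — the two branch letters produced by cutting a handle cancel: `u α + u (βα⁻¹β⁻¹) = 0`.
research route conditional on HC_CM; not a corollary; Q11.4-sentence-2 already refuted in dim ≥ 3. -/
theorem handle_term_vanishes {G : Type*} [Group G] {A : Type*} [AddCommGroup A] (u : G → A)
    (hclass : ∀ g h : G, u (h * g * h⁻¹) = u g) (hodd : ∀ g : G, u g⁻¹ = -u g) (α β : G) :
    u α + u (β * α⁻¹ * β⁻¹) = 0 := by
  rw [hclass α⁻¹ β, hodd α]
  exact add_neg_cancel (u α)

/-- ALL HANDLES ARE WITT-INVISIBLE: for any finite family of handles `(α_j, β_j)_{j ∈ J}` the sum of their branch-letter terms vanishes,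
`Σ_j (u α_j + u (β_jα_j⁻¹β_j⁻¹)) = 0`; hence (next theorem) the total class is the branch-point sum alone.
research route conditional on HC_CM; not a corollary; Q11.4-sentence-2 already refuted in dim ≥ 3. -/
theorem handles_sum_vanishes {G : Type*} [Group G] {A : Type*} [AddCommGroup A] (u : G → A)
    (hclass : ∀ g h : G, u (h * g * h⁻¹) = u g) (hodd : ∀ g : G, u g⁻¹ = -u g)
    {J : Type*} (s : Finset J) (α β : J → G) :
    (∑ j ∈ s, (u (α j) + u (β j * (α j)⁻¹ * (β j)⁻¹))) = 0 := by
  refine Finset.sum_eq_zero ?_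
  intro j _
  exact handle_term_vanishes u hclass hodd (α j) (β j)

/-- THE HANDLE LEMMA, algebraic form (THEOREMS-S25 §2′): with `u` as above, the class of the genus-0 replacement datum
`(α_1, β_1α_1⁻¹β_1⁻¹, …, α_q, β_qα_q⁻¹β_q⁻¹, g_1, …, g_b)` — which by THEOREM S21 is the sum of `u` over its letters — equals the sum over the
branch letters `g_i` alone: `Σ_j (u α_j + u (β_jα_j⁻¹β_j⁻¹)) + Σ_i u (g_i) = Σ_i u (g_i)`.
research route conditional on HC_CM; not a corollary; Q11.4-sentence-2 already refuted in dim ≥ 3. -/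
theorem handle_lemma_sum {G : Type*} [Group G] {A : Type*} [AddCommGroup A] (u : G → A)
    (hclass : ∀ g h : G, u (h * g * h⁻¹) = u g) (hodd : ∀ g : G, u g⁻¹ = -u g)
    {J I : Type*} (s : Finset J) (α β : J → G) (t : Finset I) (g : I → G) :
    (∑ j ∈ s, (u (α j) + u (β j * (α j)⁻¹ * (β j)⁻¹))) + ∑ i ∈ t, u (g i) = ∑ i ∈ t, u (g i) := by
  rw [handles_sum_vanishes u hclass hodd s α β, zero_add]

/-- An odd class function is 2-TORSION on real classes (elements conjugate to their inverse; in particular the identity and the central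
involution): `hgh⁻¹ = g⁻¹ → 2 • u g = 0` — for the Witt terms this is S21 (c) (`2u(c) = 0` on real classes; oddness alone does not give `u = 0`,
`W(ℚ_ℓ)` has 2-torsion).
research route conditional on HC_CM; not a corollary; Q11.4-sentence-2 already refuted in dim ≥ 3. -/
theorem odd_classFunction_real_class {G : Type*} [Group G] {A : Type*} [AddCommGroup A] (u : G → A)
    (hclass : ∀ g h : G, u (h * g * h⁻¹) = u g) (hodd : ∀ g : G, u g⁻¹ = -u g) (g h : G) (hreal : h * g * h⁻¹ = g⁻¹) :
    2 • u g = 0 := by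
  have hc := hclass g h
  rw [hreal, hodd] at hc
  -- hc : -u g = u g
  rw [two_nsmul]
  nth_rewrite 1 [← hc]
  exact neg_add_cancel (u g)

end Summit.HodgeConjecture.HodgeConjecture.Ring2.WeilCoverage
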